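import Mathlib
import Summits.Ventures.HodgeRepro.Tier4.Target

/-!
# Tier4/TargetV3.lean (DRAFT v3.1 = v3 + the (B2) ruling L7928 and the disclosed restrictions, lead g385 S14063) — the SUCCESSOR target `P_T4v3`: the QUANTIFIER REPAIR of `P_T4` (coordinator ruling (B), INBOX L7913;
lead g385's addendum INBOX L7915 / S13093), with the N2 central-character compatibility as a conjunct the witness satisfies

Authored by t4-typer-1 (gen 1) on the Tier-4 lead's cut (lead g385, S13093: «draft `P_T4v3` = the QUANTIFIER REPAIR, shape below,
HOME only, «TARGET-V3 DRAFT <sha256> <lines>» — NOTHING PROPOSED without the ruling»); `IsCentralModulo` co-typed with t4-typer-2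
(gen 2), variant (α) of t4-L3-p1 g2 (S13042).  Tier4/Target.lean (sha256 7e1ddb58699909ce911c9fbd810407027caa7a90f754dc3587f9e2627ee22896
· 263 l., «T4 TARGET FROZEN» S11958) is UNTOUCHED and stays the target of record until the referees countersign a successor; this file
imports it and nothing else (Mathlib + `Tier4/Target.lean`).  The v2 draft (`P_T4v2` = `P_T4` + the binder `hN2`, proofs/t4-typer-1/
Tier4/TargetV2.lean) is SUPERSEDED by this file and stays deposited in HOME as the record of the intermediate step.

## THE RULING (INBOX L7913, verbatim)

«OPS (coordinator ruling on STATUS l.12928, relayed by operator priority9): (B) AUTHORISED — one successor declaration P_T4v2 in a NEW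
file (Target.lean untouched), typed to TIER3 §1 item 3 with the N2 central-character compatibility displayed as an explicit hypothesis
and nothing else added; post «T4 TARGET-V2 FROZEN <sha256> <lines>» on STATUS when landed; critics read and the referees countersign
FAITHFUL/NOT-FAITHFUL against §1 item 3 as before; lines may re-target on the countersign; the 24-h clock runs unchanged. The paper
refutation of P_T4-as-frozen and its conditional kernel bridge are part of the Tier-4 record and will be reported at CLOSE alongside the
v2 outcome.»

## THE (B2) RULING (INBOX L7928, 2026-08-29T02:17:21Z, verbatim)

«(coordinator ruling on INBOX L7915–L7917, relayed by operator priority9): (B2) AUTHORISED — one successor declaration P_T4v3 in a NEW file (Target.lean and any V2 file untouched), typed to TIER3 §1 item 3 with the quantifier repair and every restriction relative to print DISCLOSED in its docstring; post «T4 TARGET FROZEN v3 <sha256> <lines>» on STATUS when landed; critics read and the referees countersign FAITHFUL/NOT-FAITHFUL against §1 item 3 (test unchanged: no undisclosed weakening at the printed instance, no kernel counter-model, every built-in hypothesis disclosed); lines may re-target on the countersign; the 24-h clock runs unchanged. The paper refutations of P_T4 and P_T4v2 (members and named inputs) are part of the Tier-4 record and will be reported at CLOSE beside the v3 outcome. The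 operator regrets the delay in answering L7917.»

## RESTRICTIONS RELATIVE TO PRINT (disclosed, one line each — the (B2) ruling's requirement)

(a) The ∃ over a deeper level `Γ' ≤ Γ` and a RE-CHOSEN quadruple of Albanese lifts INTO THE SAME TORI `ℂ^{T_i}/Λ_i` (no twist
    object, no `Λ'`): the route's admissible quadruples reach the given tori through isogenies (S13115 (1)), so no instance of item 3
    is lost; the ∃ is what item 3's «for some choice» says.
(b) The `hN2` conjunct in the DATUM-VISIBLE sense (eigen-relations under the central-type `γ` of every deeper principal level, with
    `χ₁χ₂ = χ₃χ₄`): it also admits the cube family (a pure quadruple with `ψ ∈ Â(N)³ ∖ {1}`), so `P_T4v3` = «item 3's (P) OR (P) on a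
    cube-family quadruple» — WEAKER than the print by exactly that disjunct, and NOT claimed equivalent to item 3 (crit-1 S13128 (3)).
(c) On the conjugate-re-indexed faces `(T, T′, T̄, T̄′)` (`T_{i₃} = T̄_{i₁}`, `T_{i₄} = T̄_{i₂}`) the ∃ is trivially witnessed by the
    conjugate re-indexing ((N5), crit-2 S13145): a note on the SCOPE (the class is not open there), not a weakening of the print.
(d) The built-in hypotheses are (H1)–(H5) of Target.lean, unchanged, plus the N2 conjunct (H6) on the witness; NOT built in, as in
    Target.lean: no identification `f^*Ω_s = θ(μ_0) ∧ θ(μ_1)`, no seesaw / doubling identity, no L-value, no density theorem, no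
    non-vanishing of any kind.

## WHY THE QUANTIFIER, NOT A BINDER (lead g385 S13093, INBOX L7915; t4-crit-2 g2 OBJECTION-V2-3, S13083)

`P_T4` is UNIVERSAL over the quadruple of Albanese lifts `a` (every quadruple of lifts onto corners of the face's CM types).  TIER3.md
§1 item 3 is EXISTENTIAL in the quadruple and in the translates: «(P) for SOME choice of the Hecke translates», on a face «whose Albanese
has the four corners as isogeny factors» — the corners being the ones the route constructs, with the fourth character FORCED by N2
(«three twists free, the fourth forced») and the signs fixed by (S3) («(R2) ⟺ ∃ x_j ∈ S_j with x₀x₁ = x₂x₃»).  Two members of the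
universal family refute the ∀-form on paper: (i) the cubic-twisted member (one corner twisted by a 3-torsion anticyclotomic `ε₀`; the
product character `ψ(z₁) ≠ 1` on a 3-torsion central idele; the integral vanishes for every level, translate and domain — t4-plan-3 g2,
TWIST-NEGATION-PROBE §8.3; refutes `P_T4` ON PAPER, modulo the four named inputs (E1)–(E4) (crit-2 S13000; the data sheet and the
kernel bridge T1/T2 due 01:30Z)); (ii) the ROOT-NUMBER member `X″ = (ν₀, ν₁, ν₂ε₀, ν₃ε₀)` (crit-2 S13083 (D): `ε₀` a quadratic
anticyclotomic character flipping the two `(0,2)`-root numbers — the root numbers of the two `s̄`-slots `i₃, i₄`, TIER3's slots 2, 3; N2 EXACT in every sense, so `hN2` holds and `P_T4v2` asserts (P) on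
it, yet `L(½, χ₂′ε̃₀) = L(½, χ₃′ε̃₀) = 0` by the functional equation and the pairing is `0` for every translate by TIER3's own «(R2) ⟺»
— refutes `P_T4v2`).  The defect class is therefore the QUANTIFIER inherited from `P_T4`, not a missing binder: the faithful successor
asserts the EXISTENCE of a level `Γ′ ≤ Γ` and of a quadruple of Albanese lifts at that level, N2-compatible, with some Hecke
translates and some fundamental domain on which the pairing is non-zero — exactly item 3's «for some choice».  Test (i): TIER3's
post-(S3) quadruple is a witness; the cubic-twisted member, the quadratic-twisted member and `X″` are NOT instances of `P_T4v3`
(they are other quadruples, not the witness).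

## THE SENTENCE FORMALISED (TIER3.md v1.14 = route/m18/route/TIER3.md, §1 item 3, quoted verbatim)

«On a face, S4 is EQUIVALENT (ROUTE.md §1 row S4ᴾ, Lemma Π = Appendix A5, CELL from printed ingredients) to the period statement, and
closer **C7** (§4 item 2) reduces it to ONE crux at p = 2: **(P) for some choice of the Hecke translates, ⟨f^*Ω_s, f^*Ω_{s̄}⟩_{L²(X)} ≠ 0**
— X a compact 2-ball quotient (Picard modular surface of an anisotropic hermitian 3-space V over a Galois CM field E′ ⊇ F, [E′⁺:ℚ] ≥ 2)
whose Albanese has the four corners as isogeny factors (Liu 2021 Cor 4.20, UNCONDITIONAL at n = 3 — ROUTE.md §4 item 2 «at p = 2, n = 3,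
UNCONDITIONAL — Liu Rem 4.14, DR Thm 3.2»), f the product of Hecke-translated Albanese maps, f^*Ω_s = θ(μ_0) ∧ θ(μ_1) and
f^*Ω_{s̄} = θ(μ_2) ∧ θ(μ_3) wedges of theta lifts of U(1)-characters (BMM Cor 65 / Liu Prop 4.13, PRINTED).»

N2 (§1 item 3, bullet «(R2) ∧ (R1)»): «… the toric-period freedom is a FINITE-ORDER ANTICYCLOTOMIC twist ν_j ∈ Ξ_𝔭 per corner, and the
central-character compatibility N2 (= TP1's character condition on ONE τ) forces ν₀ν₁ = ν₂ν₃ — three twists free, the fourth forced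
(t3-p1 (C); t3-p2 §4.4bis from the Albanese side: the forced fourth character μ_{i₄,cs} := μ_{i₁,s}μ_{i₂,s}μ_{i₃,cs}^{−1} is again
conjugate-symplectic of weight one with Albanese factor the corner A_{T_{i₄}}).»  The quantifier of the crux, same bullet: «Hence
**(R2) ⟺ ∃ x_j ∈ S_j (j = 0..3) with x₀x₁ = x₂x₃, S_j := {x ∈ Ξ_𝔭 : ε(½, χ_j′x) = +1 ∧ L(½, χ_j′x) ≠ 0}**».

## WHAT THIS FILE DECLARES — and the diff from `P_T4`

* `IsCentralModulo c H N γ` — the ONE new definition (below, with its docstring; variant (α)): `γ ∈ U(H)(E)` is CENTRAL MODULO `Γ(N)`,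
  a rational realisation `γ ∈ U(H)(E) ∩ z·K(N)` of a central idele `z ∈ Z(𝔸_f) = U(1)(𝔸_{E⁺,f})`.
* `P_T4v3` — the text of `P_T4` (Target.lean L234–L259) with EXACTLY these changes, mechanically applied to the frozen text (lead g385
  S13115 (2)): the hypotheses through `(hs₄ : conjEmb s ∈ T i₄),` are UNCHANGED — in particular the universal binder
  `∀ (a : …), (∀ i, IsAlbaneseLift (T i) (Λ i) τ₀ C Γ (a i)) →` STAYS (it is the hypothesis «the given corners exist at level `Γ`»);
  (1) after `∃ (Γ' : …), IsCongruenceSubgroup … Γ' ∧ Γ' ⊆ Γ ∧` the 9-line conjunct `∃ (a' : ∀ i : Fin 4, (Fin 2 → ℂ) → (↥(T i) → ℂ)),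
  (∀ i, IsAlbaneseLift (T i) (Λ i) τ₀ C Γ' (a' i)) ∧ hN2[Γ′, a'] ∧` is INSERTED — the witness RE-CHOOSES the quadruple of Albanese
  lifts INTO THE SAME TORI `ℂ^{T_i}/Λ_i` at the deeper level `Γ'`, and `hN2[Γ′, a']` is the v2 binder's text with `Γ'` for `Γ` and
  `a'` for `a`, now a conjunct the witness must satisfy; (2) `a` → `a'` in the four lines of the integrand; (3) nothing else: the
  author's `diff` of Target.lean L234–L259 against the declaration shows the name line, the 9 inserted lines and the 4 integrand
  lines (24 diff lines; posted with the DRAFT line).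
* The trailing `section JunkTests`: typer-2's five theorems on `IsCentralModulo` (J1 `isCentralModulo_one`, J2
  `isCentralModulo_of_mem_principalCongruence`, J3 `IsCentralModulo.valuation_offDiag_le` + two helpers, variant-(α) file
  proofs/t4-typer-2/TargetV2-junk-normone.lean 57d9c2c694344bae) and THREE tests on the ∃-form (J4, J5, J6, below): the ∃ is not
  witnessed by a null `D` nor by a degenerate `a'`, and the given lifts pull back to every deeper level.  They are TESTS, not part of the target: `P_T4v3` does not mention them.

## WHY ∃ IS FAITHFUL AND NOT A TRIVIALISATION

Item 3 asserts (P) for the route's quadruple at some level and for some translates; `P_T4v3` asserts the existence of a level, a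
quadruple of Albanese lifts onto the given corners `ℂ^{T_i}/Λ_i` at that level (every corner of type `(F, T_i)` with its `𝒪_F`-stable
lattice — the universal quantifiers over `F, T, E, H, τ₀, C, Γ, s, Λ, i_k, hs_k` are unchanged), N2-compatible in the datum-visible
sense (the `hN2` conjunct: for every deeper principal level and every central-type `γ`, eigen up to additive constants with
`χ₁χ₂ = χ₃χ₄`), translates and a domain with non-zero pairing.  A prover cannot witness the `∃` cheaply: the lifts must be genuine
Albanese lifts (holomorphic, `Γ′`-equivariant modulo the lattice, with differences spanning `ℂ^{T_i}` — the zero map and every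
degenerate map are excluded, J5), the domain must be a measurable fundamental domain of the ball action (a null `D` gives integral
`0`, J4; an empty `D` is not a fundamental domain), the translates must be Hecke elements of level `Γ′` with coset representatives,
and the integral must be proved non-zero — which is (P) itself.  What the ∃ removes is exactly `P_T4`'s over-generalisation (the
members (i)–(ii) above and the mixed lifts of S13015 (b)(3)); what it keeps is every hypothesis of the setting (H1)–(H5) of
Target.lean and the N2 clause (H6).  NOT built in: unchanged from Target.lean (no identification `f^*Ω_s = θ(μ_0) ∧ θ(μ_1)`, no seesaw
/ doubling identity, no L-value, no density theorem, no non-vanishing of any kind).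

WHY THE SAME TORI SUFFICE, AND WHY THE STATEMENT IS NOT JUNK-FALSE (lead g385 S13115 (1), (3); crit-1 S13128 (1) verified).  A
route-admissible twist `A_{μ_jν_j}` (`ν_j` of finite order) has the CM type of the given corner `A_{μ_j} = ℂ^{T_j}/Λ_j`, hence is
ℂ-isogenous to it; composing the twisted lift with an `𝒪_F`-linear isogeny `A_{μ_jν_j} → A_{μ_j}` (diagonal on the `T_j`-eigen-
coordinates) gives a holomorphic, `Γ'`-equivariant-mod-`Λ_j`, full-span map — an `IsAlbaneseLift (T j) (Λ j) τ₀ C Γ'` into the GIVEN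
torus — whose coordinate forms are the twisted corner's up to non-zero scalars (which scale `jacDet` by non-zero constants; `hN2`
and `≠ 0` unaffected).  So every route-admissible quadruple is a quadruple of lifts into the given tori at a deeper level, and no
`Λ'` / twist object is needed (test (i)).  The given `a` itself, pulled back to `Γ'` (equivariance under a subgroup, J6), witnesses
`∃ a'` — so the statement never fails for want of a lift; it fails only if NO quadruple of lifts into the given tori at any deeper
level has `hN2` and a non-vanishing translated period, i.e. exactly the negation of item 3's (P) on that datum.

THE FAITHFULNESS DIRECTION — the caveat the countersign must carry (t4-crit-1 g2, S13128 (3), in the critic's words): item 3 ⟹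
`P_T4v3` (every post-(S3) route-admissible quadruple with (R2) is an instance of `∃ a'`, N2-exact hence `hN2`).  `P_T4v3` ⟹ item 3
ONLY if the witness is N2-exact; `hN2` also admits the cube family (a pure quadruple with `ψ ∈ Â(N)³ ∖ {1}`, e.g. one quadratic slot
— it lives in the same tori, so it is an admissible `a'`), and (P) on such a witness is not item 3's statement.  The datum cannot
exclude that family (OBJECTION-V2-1, structural), so `P_T4v3` is «item 3's (P) OR (P) on a cube-family quadruple» — WEAKER than the
print by exactly that disjunct: «`P_T4v3` ⟸ item 3; a proof of `P_T4v3` is a re-derivation of item 3 iff its witness is N2-exact,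
which the statement cannot require.»  This file does not call `P_T4v3` equivalent to item 3.

NOTE (t4-crit-2 g2, S13145 (N5), no objection — the suggested docstring line): on faces with `T_{i₃} = T̄_{i₁}`, `T_{i₄} = T̄_{i₂}`
(the face `(T, T′, T̄, T̄′)`, admitted by `IsRankFourFace` and by the print's «Σ_i 1_{T_i} ≡ 2») the `∃` is witnessed by the conjugate
re-indexing (`A_{T_{i₁}} ≅ A_{T̄_{i₁}}` as complex tori, `a'_{i₃} := ψ ∘ a'_{i₁}`, `hN2` automatic, `h = 1`, integrand
`conj(c₁c₂)·|jacDet(u₁,u₂)|²`) — there (P) is trivially true, the class being a product of graph classes, not an open instance;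
the content is on the other faces (for `T_{i₃} = T_{i₁}∘σ`, `σ ≠ c`, the re-indexing gives a Galois-conjugate form with a different
central character, and for non-conjugate types `Hom(A_{T_{i₁}}, A_{T_{i₃}}) = 0`).

Nothing in this file asserts anything about the truth of (P); HC_CM is NOT proved by anyone in this repository.
-/

set_option autoImplicit false

noncomputable section

open Matrix MeasureTheory NumberField
open scoped ComplexConjugate ComplexOrder

namespace Summit.Ventures.HodgeRepro.Tier4

/-- `γ ∈ U(H)(E)` is CENTRAL MODULO `Γ(N)`: `γ ∈ Z(𝔸_f)·K(N)`, i.e. at every prime `w` of `E`, `γ` is a scalar of `w`-adic size `t`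
times a `w`-unit matrix, the scalar has norm one (size `t⁻¹` at `w̄`, read at `w` through `c`), and at the primes dividing `N` the
normalised matrix is `≡ 1 mod N`.  These are exactly the rational realisations of the central ideles acting on `Γ(N)∖𝔹²`.
(`w.valuation E : Valuation E (WithZero (Multiplicative ℤ))` is Mathlib's `w`-adic valuation; `v x ≤ 1` ⟺ `x` is `w`-integral;
`γ⁻¹` is `Matrix.inv`.)  THE `ζ` CLAUSE carries the EXACT norm-one condition `c ζ * ζ = 1` (variant (α) of t4-L3-p1 g2 S13042, adopted on the
lead's ruling — the probe's `ζ ≠ 0` replaced by one conjunct): with it the paper equivalence `IsCentralModulo c H N γ ⟺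
γ ∈ U(H)(E) ∩ Z(𝔸_f)·K(N)` holds at EVERY place with no local lifting question — (⇐) weak approximation for the rational norm-one torus
`R¹_{E/E⁺}𝔾_m` gives a global `ζ` with `c(ζ)ζ = 1` and `ζ ≡ z_w (mod N)` at `w ∣ N`; (⇒) `z_w := ζ` at `w ∣ N` is norm-one exactly, and at
`w ∤ N` any `z_w` of size `t` with `z_{w̄} := c(z_w)⁻¹` (S13042; crit-1 S13063 (2) verified both directions).  `ζ = 1` is norm-one, so the
junk tests (J1), (J2) are unchanged. -/
def IsCentralModulo {E : Type} [Field E] [NumberField E] (c : E ≃+* E) (H : Matrix (Fin 3) (Fin 3) E) (N : ℕ)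
    (γ : Matrix (Fin 3) (Fin 3) E) : Prop :=
  IsUnitaryOf c H γ ∧
  (∀ w : IsDedekindDomain.HeightOneSpectrum (𝓞 E), ∃ t : WithZero (Multiplicative ℤ), t ≠ 0 ∧
    (∀ i j, w.valuation E (γ i j) ≤ t) ∧ (∀ i j, w.valuation E (γ⁻¹ i j) ≤ t⁻¹) ∧
    (∀ i j, w.valuation E (c (γ i j)) ≤ t⁻¹) ∧ (∀ i j, w.valuation E (c (γ⁻¹ i j)) ≤ t)) ∧
  (∃ ζ : E, c ζ * ζ = 1 ∧ ∀ w : IsDedekindDomain.HeightOneSpectrum (𝓞 E), w.valuation E (N : E) < 1 →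
    ∀ i j, w.valuation E (ζ⁻¹ * γ i j - (1 : Matrix (Fin 3) (Fin 3) E) i j) ≤ w.valuation E (N : E))

/-- **P_T4v3** — the statement (P) of TIER3.md §1 item 3 as an EXISTENTIAL in the level, the quadruple of Albanese lifts (N2-compatible)
and the translates: the text of `P_T4` (Target.lean L234–L259) with the universal binder over the lifts removed and the conjunct
`∃ a, (∀ i, IsAlbaneseLift … Γ' (a i)) ∧ hN2[Γ′, a]` inserted after `Γ' ⊆ Γ ∧`, as described in the module docstring. -/
def P_T4v3 : Prop :=
  ∀ (F : Type) [Field F] [NumberField F] [IsGalois ℚ F] [IsCMField F]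
    (T : Fin 4 → Finset (F →+* ℂ)), IsRankFourFace F T →
  ∀ (E : Type) [Field E] [NumberField E] [IsGalois ℚ E] [IsCMField E],
    2 ≤ Module.finrank ℚ (maximalRealSubfield E) →
  ∀ (_ι : F →+* E) (H : Matrix (Fin 3) (Fin 3) E),
    IsCHermitian (IsCMField.complexConj E).toRingEquiv H →
    Anisotropic (IsCMField.complexConj E).toRingEquiv H →
  ∀ (τ₀ : E →+* ℂ), (∀ τ : E →+* ℂ, τ ≠ τ₀ → τ ≠ conjEmb τ₀ → IsDefinite (H.map τ)) →
  ∀ (C : Matrix (Fin 3) (Fin 3) ℂ), IsSylvester (H.map τ₀) C →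
  ∀ (Γ : Set (Matrix (Fin 3) (Fin 3) E)), IsCongruenceSubgroup (IsCMField.complexConj E).toRingEquiv H Γ →
  ∀ (s : F →+* ℂ)
    (Λ : ∀ i : Fin 4, Submodule ℤ (↥(T i) → ℂ)) [∀ i, DiscreteTopology (Λ i)] [∀ i, IsZLattice ℝ (Λ i)],
    (∀ i, IsOFStable (T i) (Λ i)) →
  ∀ (a : ∀ i : Fin 4, (Fin 2 → ℂ) → (↥(T i) → ℂ)), (∀ i, IsAlbaneseLift (T i) (Λ i) τ₀ C Γ (a i)) →
  ∀ (i₁ i₂ i₃ i₄ : Fin 4), i₁ ≠ i₂ → i₃ ≠ i₄ →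
  ∀ (hs₁ : s ∈ T i₁) (hs₂ : s ∈ T i₂) (hs₃ : conjEmb s ∈ T i₃) (hs₄ : conjEmb s ∈ T i₄),
  ∃ (Γ' : Set (Matrix (Fin 3) (Fin 3) E)),
    IsCongruenceSubgroup (IsCMField.complexConj E).toRingEquiv H Γ' ∧ Γ' ⊆ Γ ∧
  ∃ (a' : ∀ i : Fin 4, (Fin 2 → ℂ) → (↥(T i) → ℂ)), (∀ i, IsAlbaneseLift (T i) (Λ i) τ₀ C Γ' (a' i)) ∧
    (∀ N : ℕ, 1 ≤ N → principalCongruence (IsCMField.complexConj E).toRingEquiv H N ⊆ Γ' →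
      ∀ γ : Matrix (Fin 3) (Fin 3) E, IsCentralModulo (IsCMField.complexConj E).toRingEquiv H N γ →
      ∃ χ₁ χ₂ χ₃ χ₄ : ℂ,
        (∃ d : ℂ, ∀ z ∈ ball, comp (T i₁) s hs₁ (a' i₁) (actM (toBallMat τ₀ C γ) z) = χ₁ * comp (T i₁) s hs₁ (a' i₁) z + d) ∧
        (∃ d : ℂ, ∀ z ∈ ball, comp (T i₂) s hs₂ (a' i₂) (actM (toBallMat τ₀ C γ) z) = χ₂ * comp (T i₂) s hs₂ (a' i₂) z + d) ∧
        (∃ d : ℂ, ∀ z ∈ ball, comp (T i₃) (conjEmb s) hs₃ (a' i₃) (actM (toBallMat τ₀ C γ) z) = χ₃ * comp (T i₃) (conjEmb s) hs₃ (a' i₃) z + d) ∧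
        (∃ d : ℂ, ∀ z ∈ ball, comp (T i₄) (conjEmb s) hs₄ (a' i₄) (actM (toBallMat τ₀ C γ) z) = χ₄ * comp (T i₄) (conjEmb s) hs₄ (a' i₄) z + d) ∧
        χ₁ * χ₂ = χ₃ * χ₄) ∧
  ∃ (h : Fin 4 → HeckeElement E), (∀ i, (h i).IsFor (IsCMField.complexConj E).toRingEquiv H Γ') ∧
  ∃ (D : Set (Fin 2 → ℂ)), IsFundamentalDomainFor (ballActions τ₀ C Γ') D ∧
    ∫ z in D,
      jacDet (comp (T i₁) s hs₁ (heckeTranslate τ₀ C (h i₁) (a' i₁)))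
             (comp (T i₂) s hs₂ (heckeTranslate τ₀ C (h i₂) (a' i₂))) z *
      conj (jacDet (comp (T i₃) (conjEmb s) hs₃ (heckeTranslate τ₀ C (h i₃) (a' i₃)))
                   (comp (T i₄) (conjEmb s) hs₄ (heckeTranslate τ₀ C (h i₄) (a' i₄))) z) ≠ 0

/-! ## Junk tests — what the ∃-form does and does not admit

(J1) `IsCentralModulo c H N 1` (`t = 1`, `ζ = 1`); (J2) `γ ∈ Γ(N) ∩ Γ` ⇒ `IsCentralModulo c H N γ` (so the `hN2` conjunct holds with
`χ_k = 1` on the level's own elements — consistent with `IsAlbaneseLift`'s equivariance); (J3) at `w ∣ N` the off-diagonal entries of a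
central-modulo-`N` matrix are `≡ 0 mod N` relative to the diagonal — a non-central normaliser element is NOT `IsCentralModulo` (the
necessary condition, generic).  All three: t4-typer-2 g2, variant (α), verbatim below.
(J4) The `∃ D` is NOT witnessed by a null set: the integral over a null `D` is `0`, so `∫ z in D, … ≠ 0` fails
(`integral_null_eq_zero` below, for every integrand).
(J5) The `∃ a'` is NOT witnessed by a degenerate quadruple: the zero map (any constant map) is not an Albanese lift when the corner is
non-trivial — `IsAlbaneseLift`'s span clause `span {a z − a z'} = ⊤` fails (`not_isAlbaneseLift_const` below).
(J6) The given lifts pull back to every deeper level: `IsAlbaneseLift T Λ τ₀ C Γ a → Γ' ⊆ Γ → IsAlbaneseLift T Λ τ₀ C Γ' a`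
(`IsAlbaneseLift.mono` below) — so `∃ a'` is never empty for want of a lift (the statement is not junk-false), and its content is the
`hN2` clause and the non-vanishing. -/

section JunkTests

variable {E : Type} [Field E] [NumberField E]

/-- An algebraic integer is `w`-integral at every finite place: `v_w(x) ≤ 1`. -/
theorem valuation_le_one_of_isIntegral (w : IsDedekindDomain.HeightOneSpectrum (𝓞 E)) {x : E} (hx : IsIntegral ℤ x) :
    w.valuation E x ≤ 1 := by
  have h := IsDedekindDomain.HeightOneSpectrum.valuation_le_one (K := E) w ⟨x, hx⟩
  simpa using h

/-- The entries of the identity matrix are `w`-integral. -/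
theorem valuation_one_apply_le (w : IsDedekindDomain.HeightOneSpectrum (𝓞 E)) (i j : Fin 3) :
    w.valuation E ((1 : Matrix (Fin 3) (Fin 3) E) i j) ≤ 1 := by
  rcases eq_or_ne i j with rfl | hij
  · simp
  · simp [hij]

/-- **Junk test 1**: the identity is central modulo every `N` (`t = 1`, `ζ = 1`). -/
theorem isCentralModulo_one (c : E ≃+* E) (H : Matrix (Fin 3) (Fin 3) E) (N : ℕ) : IsCentralModulo c H N 1 := by
  refine ⟨?_, fun w => ⟨1, one_ne_zero, ?_, ?_, ?_, ?_⟩, 1, by simp, ?_⟩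
  · show cstar c 1 * H * 1 = H
    simp [cstar, Matrix.map_one c (map_zero c) (map_one c)]
  · intro i j; exact valuation_one_apply_le w i j
  · intro i j; simp only [inv_one]; exact valuation_one_apply_le w i j
  · intro i j
    simp only [inv_one]
    rcases eq_or_ne i j with rfl | hij
    · simp
    · simp [hij]
  · intro i j
    simp only [inv_one]
    rcases eq_or_ne i j with rfl | hij
    · simp
    · simp [hij]
  · intro w _ i j
    simp

/-- **Junk test 2**: an element of `Γ(N)` lying in a congruence subgroup `Γ` (so that its inverse is integral) is
central modulo `N` (`t = 1`, `ζ = 1`) — `hN2` is consistent with the `Γ`-equivariance of the Albanese lifts. -/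
theorem isCentralModulo_of_mem_principalCongruence (c : E ≃+* E) (H : Matrix (Fin 3) (Fin 3) E) (N : ℕ)
    {Γ : Set (Matrix (Fin 3) (Fin 3) E)} (hΓ : IsCongruenceSubgroup c H Γ) {γ : Matrix (Fin 3) (Fin 3) E}
    (hγ : γ ∈ Γ) (hN : γ ∈ principalCongruence c H N) : IsCentralModulo c H N γ := by
  obtain ⟨hU, hint, hcong⟩ := hN
  obtain ⟨h, hh, hγh⟩ := hΓ.2.2.1 γ hγ
  have hinv : γ⁻¹ = h := Matrix.inv_eq_right_inv hγh
  have hhint : IsIntegralMatrix h := (hΓ.2.2.2.1 hh).2.1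
  refine ⟨hU, fun w => ⟨1, one_ne_zero, ?_, ?_, ?_, ?_⟩, 1, by simp, ?_⟩
  · intro i j; exact valuation_le_one_of_isIntegral w (hint i j)
  · intro i j; rw [hinv, inv_one]; exact valuation_le_one_of_isIntegral w (hhint i j)
  · intro i j; rw [inv_one]; exact valuation_le_one_of_isIntegral w (map_isIntegral_int c (hint i j))
  · intro i j; rw [hinv]; exact valuation_le_one_of_isIntegral w (map_isIntegral_int c (hhint i j))
  · intro w _ i j
    obtain ⟨x, hx, hx'⟩ := hcong i j
    rw [inv_one, one_mul, hx', Valuation.map_mul]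
    calc w.valuation E (N : E) * w.valuation E x ≤ w.valuation E (N : E) * 1 :=
          mul_le_mul_right (valuation_le_one_of_isIntegral w hx) _
      _ = w.valuation E (N : E) := mul_one _

/-- **What `IsCentralModulo` excludes** (the third junk test, as a necessary condition): at every place `w | N`,
the off-diagonal entries of a central-modulo-`N` matrix are divisible by `N` relative to the diagonal —
`v_w(γ i j) ≤ v_w(N) · v_w(γ k k)` for `i ≠ j` — so a non-central element such as a unipotent `1 + e_{01}` with an
entry not divisible by `N` is NOT central modulo `N`. -/
theorem IsCentralModulo.valuation_offDiag_le {c : E ≃+* E} {H : Matrix (Fin 3) (Fin 3) E} {N : ℕ}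
    {γ : Matrix (Fin 3) (Fin 3) E} (h : IsCentralModulo c H N γ) (w : IsDedekindDomain.HeightOneSpectrum (𝓞 E))
    (hw : w.valuation E (N : E) < 1) (i j k : Fin 3) (hij : i ≠ j) :
    w.valuation E (γ i j) ≤ w.valuation E (N : E) * w.valuation E (γ k k) := by
  obtain ⟨-, -, ζ, hζn, hcond⟩ := h
  have hζ : ζ ≠ 0 := by
    intro h0
    rw [h0, mul_zero] at hζn
    exact zero_ne_one hζn
  have hζ0 : w.valuation E ζ ≠ 0 := (Valuation.ne_zero_iff _).2 hζ
  -- the diagonal entry `k`: `v(ζ⁻¹ γ k k − 1) ≤ v(N) < 1` forces `v(ζ⁻¹ γ k k) = 1`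
  have hkk := hcond w hw k k
  simp only [Matrix.one_apply_eq] at hkk
  have hdiag : w.valuation E (ζ⁻¹ * γ k k) = 1 := by
    have := Valuation.map_one_add_of_lt (w.valuation E) (lt_of_le_of_lt hkk hw)
    simpa using this
  -- the off-diagonal entry: `v(ζ⁻¹ γ i j) ≤ v(N)`
  have hij' := hcond w hw i j
  rw [Matrix.one_apply_ne hij, sub_zero] at hij'
  rw [Valuation.map_mul, map_inv₀] at hij' hdiag
  have hk : w.valuation E (γ k k) = w.valuation E ζ := by
    have := hdiag
    rw [inv_mul_eq_one₀ hζ0] at this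
    exact this.symm
  rw [hk]
  have := hij'
  rw [inv_mul_le_iff₀ (zero_lt_iff.2 hζ0)] at this
  calc w.valuation E (γ i j) ≤ w.valuation E ζ * w.valuation E (N : E) := this
    _ = w.valuation E (N : E) * w.valuation E ζ := mul_comm _ _

/-- **(J4)** the integral over a null domain vanishes — a null `D` never witnesses the `∃ D`. -/
theorem integral_null_eq_zero {D : Set (Fin 2 → ℂ)} (hD : MeasureTheory.volume D = 0) (f : (Fin 2 → ℂ) → ℂ) :
    ∫ z in D, f z = 0 := by
  rw [MeasureTheory.Measure.restrict_eq_zero.2 hD, MeasureTheory.integral_zero_measure]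

omit [NumberField E] in
/-- **(J5)** a constant map is not an Albanese lift onto a non-trivial corner (`T` non-empty): the span clause fails. -/
theorem not_isAlbaneseLift_const {K : Type} [Field K] (T : Finset (K →+* ℂ)) (hT : T.Nonempty) (Λ : Submodule ℤ (↥T → ℂ))
    (τ₀ : E →+* ℂ) (C : Matrix (Fin 3) (Fin 3) ℂ) (Γ : Set (Matrix (Fin 3) (Fin 3) E)) (v : ↥T → ℂ) :
    ¬ IsAlbaneseLift T Λ τ₀ C Γ (fun _ => v) := by
  rintro ⟨-, -, hspan⟩
  have hset : {w : ↥T → ℂ | ∃ z ∈ ball, ∃ z' ∈ ball, w = (fun _ : Fin 2 → ℂ => v) z - (fun _ : Fin 2 → ℂ => v) z'} ⊆ {0} := by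
    rintro w ⟨z, -, z', -, rfl⟩
    simp
  have hbot : Submodule.span ℂ {w : ↥T → ℂ | ∃ z ∈ ball, ∃ z' ∈ ball, w = (fun _ : Fin 2 → ℂ => v) z - (fun _ : Fin 2 → ℂ => v) z'} = ⊥ := by
    rw [eq_bot_iff]
    calc Submodule.span ℂ _ ≤ Submodule.span ℂ {(0 : ↥T → ℂ)} := Submodule.span_mono hset
      _ = ⊥ := by simp
  rw [hspan] at hbot
  obtain ⟨σ, hσ⟩ := hT
  have hone : (fun _ : ↥T => (1 : ℂ)) ∈ (⊤ : Submodule ℂ (↥T → ℂ)) := Submodule.mem_top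
  rw [hbot, Submodule.mem_bot] at hone
  have := congrFun hone ⟨σ, hσ⟩
  simp at this

omit [NumberField E] in
/-- **(J6)** an Albanese lift at level `Γ` is an Albanese lift at every deeper level `Γ' ⊆ Γ` (equivariance under a subgroup; the
holomorphy and the span clause are unchanged). -/
theorem IsAlbaneseLift.mono {K : Type} [Field K] {T : Finset (K →+* ℂ)} {Λ : Submodule ℤ (↥T → ℂ)} {τ₀ : E →+* ℂ}
    {C : Matrix (Fin 3) (Fin 3) ℂ} {Γ Γ' : Set (Matrix (Fin 3) (Fin 3) E)} {a : (Fin 2 → ℂ) → (↥T → ℂ)}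
    (ha : IsAlbaneseLift T Λ τ₀ C Γ a) (hsub : Γ' ⊆ Γ) : IsAlbaneseLift T Λ τ₀ C Γ' a :=
  ⟨ha.1, fun γ hγ z hz => ha.2.1 γ (hsub hγ) z hz, ha.2.2⟩

end JunkTests

end Summit.Ventures.HodgeRepro.Tier4

end
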